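import Summits.QuantumFields.BalabanUV.Beta.D1BFx.NeedleGroupPointwise
import Summits.QuantumFields.BalabanUV.Beta.D1BFx.RestTotalOfGroups

/-!
# `BalabanUV.Beta.D1BFx.NeedleRowGlue` — road «BF-x» for binder row D1, slot (K), census group **NEEDLES ∪ G_R**: THE END's NEEDLE ROW `hGrp gN`
# (`RoadEndBFxTotalShellGroups.d1Drift_BFx_total_shell_of_prop12_of_groups`, p252741) REDUCED TO EIGHT DISPLAYED TABLE ROWS — owner «NEEDLE-GLUE»
# (the consumer of (N-0) `NeedleGroupPointwise` v1.1 and the socket the (N-2) «NEEDLE-SUPERPOSITION» bounds plug into; `NEEDLE-BOUND-NOTES.md` v1 §5)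

HONEST DEPENDENCY (page 1, mandatory): continuum YM on T⁴ ⇐ BetaPertH ∧ nine spine estimates (0/9 proved); BetaPertH ⇐ (D1) ∧ (D4) ∧
CAP+tail; G-an2-4 gates asym, D1 and NE2/3/4.  HONEST FRAMING (cell contract, verbatim): «discharging `BetaPertH` makes Bałaban's UV
stability UNCONDITIONAL — a real constructive-QFT result; it is NOT the continuum limit and NOT the Clay problem.»  THIS MODULE DISCHARGES
NOTHING of the wall: [folklore] bookkeeping BY NAME — the pointwise identity `NeedleGroupPointwise.sum_needleFibre'_restK'` (p255534 + v1.1) pushed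
through the punctured full sum (`WindowIdentification.fullSum_const_mul`, `Assembly.fullSum_finset_sum_const_mul`, every table integrand convergent by
`FineHessianSectors.absMoment₂_baseKer_biBubbleTable` ∕ `DressedTablesLeg.absMoment₂_baseKer_tadpoleTableA` with the legs' `Spr` and the stencils'
bi-localisation — `SectorRecut.exists_biLoc_SbT`∕`exists_biLoc_SbRc`, `GhostStencil.biLoc_ghCur`, `GhostStencilRooted.biLoc_qAntiAt`,
`GhostKernelComplete.biLoc_WghAt_ctr`), the base-site average, and the triangle inequality.  EVERY table row bound stays a DISPLAYED hypothesis
(`h₁ … h₈`): NO estimate of Bałaban's is proved here; the needle row's constant is `C₁ + ⋯ + C₈` of the (N-2) bounds, nothing else.  No `Prop` minted,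
nothing cited, no printed statement as hypothesis, 0 sorry.  0 wall binders (root-level hW ∕ hR-sockets ∕ hSX-socket ∕ D1Tel ∕ D1Rep — 0); (K) NOT
closed; NOT D1, NOT `BetaPertH`, NOT continuum, NOT Clay.

ABSOLUTE RULE (cell charter, verbatim): «No internally-minted statement may enter as a cited fact. Every hypothesis is either kernel-proved in
this package or a verbatim quotation of a PUBLISHED theorem with page reference. The manuscript(s) under audit are NOT citable for their own
disputed steps — they are the thing under adjudication; programme-internal (2001/route/tribunal) claims are never citable.»

WHY (owner `NEEDLE-BOUND-NOTES.md` v1 §5, `K-END-RESHAPE-GROUPS.md` §3).  The END of record takes ONE n-uniform bound per identity-closed group of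
rest words.  For the needle group (`grp τ = gN ↔ τ ∈ needleFibre'`, the fibre of record of ruling ρ-g9-26) the frozen profile DROPS OUT pointwise
(`sum_needleFibre'_restK'`) and the group is a fixed linear combination of EIGHT profile-free tables over the full legs: gluon `SbT ⊗ SbRc`,
`SbRc ⊗ SbT`, `SbRc ⊗ SbRc` (over `Ga n a`), ghost `ghCur ⊗ qA`, `qA ⊗ ghCur`, `qA ⊗ qA` (over `Ggh n a`, `qA := qAntiAt (ctrHalf n) n`), the completed
ghost tadpole `tadpoleTableA (Ggh n a) (WghAt (ctrHalf n) n x₀ cK cQ)` and the slot-4 tadpole `tadpoleTable n a WQ`.  So `hGrp gN` follows from one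
n-uniform bound per TABLE ROW `coef(n) · Σ_{b} n⁻⁴ · (n⁻⁸ · fullSum (w ↦ w_μ w_ν · T μ ν (b+w) b))` — the (N-2) currency — with constant the sum of the
eight.  This file is that reduction and nothing more.

CONTENT.
* §1 [folklore] convergence of the eight weighted table integrands at a base site (`conv_bubble`, `conv_tadpoleA`, the stencil sockets `biLoc_SbT'`,
  `biLoc_SbRc'`, `biLoc_ghCur'`, `biLoc_qA'`).
* §2 [folklore] **`fullSum_needleFibre'_eq`** — at a fixed block size, base site and ANY exponentially bounded profile: the full sum of the needle group
  = `n⁻⁸ · (ωgl·(cE·FS₁ + cE·FS₂ + FS₃) + ωgh·(cK cQ·FS₄ + cQ cK·FS₅ + cQ²·FS₆ + FS₇) + ωgl·cQ₂·FS₈)`, `FSᵢ := fullSum (w ↦ w_μ w_ν · Tᵢ μ ν (b+w) b)`.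
* §3 [folklore] **`abs_gN_row_le_of_tables`** — IN THE END's CURRENCY (`∀ n ≥ 2, [NeZero n]`, profile `gfrz n a b`, coefficient and table SEQUENCES,
  `lam := n⁸`): `|Σ_{b ∈ image resSite} n⁻⁴ · fullSum (w ↦ Σ_{τ : grp τ = gN} restK' … b τ w)| ≤ C₁ + C₂ + C₃ + C₄ + C₅ + C₆ + C₇ + C₈` from the eight
  displayed table-row bounds `h₁ … h₈`, the fibre datum `hfib`, `0 < a`, `Spr (Ga n a)`, and the slot-4 socket `hQ` (the END's own).
Unit `b2b-balaban-beta-d1-p2` (gen 9), road «BF-x» OWNER, BINDER-OWNERS row D1 co-owner.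
-/

noncomputable section

open Finset Filter Topology
open scoped BigOperators
open Literature.MathematicalPhysics.QuantumFieldTheory.Balaban1983to89
open Literature.MathematicalPhysics.QuantumFieldTheory.Balaban1983to89.Beta
open WindowIdentification (fullSum psum fullSum_const_mul)
open B12Sec2to5 (l1)
open DyadicShell (Pt toReal)
open ExpKernelCalculus (Site MKer BiLoc)
open DressedMomentNormalisation (resSite)
open Summit.QuantumFields.BalabanUV.Beta.TameKernelCalculus (Spr)
open Summit.QuantumFields.BalabanUV.Beta.D1BFx.MomentTransferPeriodic (baseKer)
open Summit.QuantumFields.BalabanUV.Beta.D1BFx.GluonLeg (Ga)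
open Summit.QuantumFields.BalabanUV.Beta.D1BFx.GhostLeg (Ggh spr_Ggh)
open Summit.QuantumFields.BalabanUV.Beta.D1BFx.GhostStencil (ghCur biLoc_ghCur)
open Summit.QuantumFields.BalabanUV.Beta.D1BFx.GhostStencilRooted (qAntiAt biLoc_qAntiAt)
open Summit.QuantumFields.BalabanUV.Beta.D1BFx.GhostStencilRootedReflection (ctrHalf ctrHalf_mem)
open Summit.QuantumFields.BalabanUV.Beta.D1BFx.ReducedKernel (TableR)
open Summit.QuantumFields.BalabanUV.Beta.D1BFx.DressedTadpoleTable (tadpoleTable)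
open Summit.QuantumFields.BalabanUV.Beta.D1BFx.DressedTablesLeg (tadpoleTableA absMoment₂_baseKer_tadpoleTableA)
open Summit.QuantumFields.BalabanUV.Beta.D1BFx.FineHessianSectors (biBubbleTable absMoment₂_baseKer_biBubbleTable)
open Summit.QuantumFields.BalabanUV.Beta.D1BFx.SectorRecut (SbT SbRc exists_biLoc_SbT exists_biLoc_SbRc)
open Summit.QuantumFields.BalabanUV.Beta.D1BFx.GhostAveragingSquare (WghAt)
open Summit.QuantumFields.BalabanUV.Beta.D1BFx.GhostKernelComplete (biLoc_WghAt_ctr)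
open Summit.QuantumFields.BalabanUV.Beta.D1BFx.FrozenLegProfile (gfrz decay_gfrz)
open Summit.QuantumFields.BalabanUV.Beta.D1BFx.SplitInstance (RestIdx)
open Summit.QuantumFields.BalabanUV.Beta.D1BFx.SplitRecut (restK')
open Summit.QuantumFields.BalabanUV.Beta.D1BFx.Assembly (exists_tendsto_psum_const_mul exists_tendsto_psum_finset_sum
  fullSum_finset_sum_const_mul exists_tendsto_psum_weight_mul)
open Summit.QuantumFields.BalabanUV.Beta.D1BFx.NeedleGroupPointwise (needleFibre' sum_needleFibre'_restK')

namespace Summit.QuantumFields.BalabanUV.Beta.D1BFx.NeedleRowGlue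

/-! ## §1 Convergence of the eight weighted table integrands at a base site -/

section Conv

variable {F : Type*} [Fintype F]

/-- [folklore] A `(1.22)`-weighted two-sector BUBBLE table over `Spr` legs with bi-localised stencils has convergent punctured partial sums at every base site. -/
theorem conv_bubble {A B : MKer 4 F} {S T : Fin 4 → Site 4 → MKer 4 F} (hA : Spr A) (hB : Spr B)
    (hS : ∃ Cs δs : ℝ, 0 < δs ∧ ∀ (κ : Fin 4) (u : Site 4), BiLoc (S κ u) u u Cs δs)
    (hT : ∃ Ct δt : ℝ, 0 < δt ∧ ∀ (κ : Fin 4) (u : Site 4), BiLoc (T κ u) u u Ct δt) (μ ν : Fin 4) (b : Pt) :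
    ∃ L, Tendsto (psum (fun w : Pt => toReal w μ * toReal w ν * biBubbleTable A B S T μ ν (b + w) b)) atTop (𝓝 L) := by
  obtain ⟨Cs, δs, hδs, hS⟩ := hS
  obtain ⟨Ct, δt, hδt, hT⟩ := hT
  exact exists_tendsto_psum_weight_mul (absMoment₂_baseKer_biBubbleTable A B hA hB hS hδs hT hδt μ ν b) μ ν

/-- [folklore] A `(1.22)`-weighted TADPOLE table over an `Spr` leg with a bi-localised two-bond table has convergent punctured partial sums at every base site. -/
theorem conv_tadpoleA [Nonempty F] {A : MKer 4 F} {W : Fin 4 → Site 4 → Fin 4 → Site 4 → MKer 4 F} (hA : Spr A) {CW δW : ℝ} (hδW : 0 < δW)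
    (hW : ∀ κ u l u', BiLoc (W κ u l u') u u' CW δW) (μ ν : Fin 4) (b : Pt) :
    ∃ L, Tendsto (psum (fun w : Pt => toReal w μ * toReal w ν * tadpoleTableA A W μ ν (b + w) b)) atTop (𝓝 L) :=
  exists_tendsto_psum_weight_mul (absMoment₂_baseKer_tadpoleTableA A hA hW hδW μ ν b) μ ν

/-- [folklore] The transverse bordering stencil `SbT` is bi-localised at its bond (socket form). -/
theorem biLoc_SbT' : ∃ Cs δs : ℝ, 0 < δs ∧ ∀ (κ : Fin 4) (u : Site 4), BiLoc (SbT κ u) u u Cs δs :=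
  exists_biLoc_SbT

variable (n : ℕ) [NeZero n] (a cE cR cK cQ : ℝ)

/-- [folklore] The re-cut R-sector stencil `SbRc` is bi-localised at its bond (socket form; `0 < a`). -/
theorem biLoc_SbRc' (ha : 0 < a) : ∃ Cs δs : ℝ, 0 < δs ∧ ∀ (κ : Fin 4) (u : Site 4), BiLoc (SbRc n a cE cR cK cQ κ u) u u Cs δs :=
  exists_biLoc_SbRc n a cE cR cK cQ ha

/-- [folklore] The ghost current stencil `ghCur` is bi-localised at its bond (socket form). -/
theorem biLoc_ghCur' : ∃ Cs δs : ℝ, 0 < δs ∧ ∀ (κ : Fin 4) (u : Site 4), BiLoc (ghCur κ u) u u Cs δs :=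
  ⟨_, 1, one_pos, fun κ u => biLoc_ghCur κ u 1⟩

/-- [folklore] The centre-rooted ghost averaging stencil `qAntiAt (ctrHalf n) n` is bi-localised at its bond (socket form, rate `1/n`). -/
theorem biLoc_qA' : ∃ Cs δs : ℝ, 0 < δs ∧ ∀ (κ : Fin 4) (u : Site 4), BiLoc (qAntiAt (ctrHalf n) n κ u) u u Cs δs :=
  ⟨_, _, div_pos one_pos (by exact_mod_cast Nat.pos_of_ne_zero (NeZero.ne n)),
    fun κ u => biLoc_qAntiAt n κ u (ctrHalf_mem n) zero_le_one⟩

end Conv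

/-! ## §2 The needle group's full sum at a base site = eight profile-free table full sums -/

section Fixed

variable (n : ℕ) [NeZero n] (a : ℝ) {g : Pt → ℝ} (cE cΛ cR cK cQ cE₂ cJ4 cΛ₂ cR₂ cQ₂ x₀ : ℝ) (WE WJ WΛ WR WQ : TableR)
  (ωgl ωgh lam N : ℝ) (μ ν : Fin 4) (b : Pt) {C δ CQ δW : ℝ}

/-- [folklore] **THE FULL SUM OF THE NEEDLE GROUP OF RECORD AT A BASE SITE IS A FIXED COMBINATION OF EIGHT PROFILE-FREE TABLE FULL SUMS** (for ANY
exponentially bounded profile `g` — it has dropped out —, `0 < a`, `Spr (Ga n a)`, the slot-4 socket `hQ`):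
`fullSum (w ↦ Σ_{τ ∈ needleFibre'} restK' … b τ w) = n⁻⁸ · (ωgl·(cE·FS₁ + cE·FS₂ + FS₃) + ωgh·(cK cQ·FS₄ + cQ cK·FS₅ + cQ cQ·FS₆ + FS₇) + ωgl·(cQ₂·FS₈))`. -/
theorem fullSum_needleFibre'_eq (ha : 0 < a) (hGa : Spr (Ga n a)) (hδ : 0 < δ) (hg : ∀ v, |g v| ≤ C * Real.exp (-δ * l1 v)) (hδW : 0 < δW)
    (hQ : ∀ κ u l u', BiLoc (WQ κ u l u') u u' CQ δW) :
    fullSum (fun w : Pt => ∑ τ ∈ needleFibre', restK' n a g cE cΛ cR cK cQ cE₂ cJ4 cΛ₂ cR₂ cQ₂ x₀ WE WJ WΛ WR WQ ωgl ωgh lam N μ ν b τ w)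
      = ((n : ℝ) ^ 8)⁻¹ * (
          ωgl * (cE * fullSum (fun w : Pt => toReal w μ * toReal w ν * biBubbleTable (Ga n a) (Ga n a) SbT (SbRc n a cE cR cK cQ) μ ν (b + w) b)
            + cE * fullSum (fun w : Pt => toReal w μ * toReal w ν * biBubbleTable (Ga n a) (Ga n a) (SbRc n a cE cR cK cQ) SbT μ ν (b + w) b)
            + fullSum (fun w : Pt => toReal w μ * toReal w ν *
                biBubbleTable (Ga n a) (Ga n a) (SbRc n a cE cR cK cQ) (SbRc n a cE cR cK cQ) μ ν (b + w) b))
        + ωgh * (cK * cQ * fullSum (fun w : Pt => toReal w μ * toReal w ν * biBubbleTable (Ggh n a) (Ggh n a) ghCur (qAntiAt (ctrHalf n) n) μ ν (b + w) b)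
            + cQ * cK * fullSum (fun w : Pt => toReal w μ * toReal w ν * biBubbleTable (Ggh n a) (Ggh n a) (qAntiAt (ctrHalf n) n) ghCur μ ν (b + w) b)
            + cQ * cQ * fullSum (fun w : Pt => toReal w μ * toReal w ν *
                biBubbleTable (Ggh n a) (Ggh n a) (qAntiAt (ctrHalf n) n) (qAntiAt (ctrHalf n) n) μ ν (b + w) b)
            + fullSum (fun w : Pt => toReal w μ * toReal w ν * tadpoleTableA (Ggh n a) (WghAt (ctrHalf n) n x₀ cK cQ) μ ν (b + w) b))
        + ωgl * (cQ₂ * fullSum (fun w : Pt => toReal w μ * toReal w ν * tadpoleTable n a WQ μ ν (b + w) b))) := by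
  classical
  have hGgh : Spr (Ggh n a) := spr_Ggh n a ha
  -- the eight profile-free weighted table integrands and their coefficients
  set K : Fin 8 → Pt → ℝ := ![
      fun w : Pt => toReal w μ * toReal w ν * biBubbleTable (Ga n a) (Ga n a) SbT (SbRc n a cE cR cK cQ) μ ν (b + w) b,
      fun w : Pt => toReal w μ * toReal w ν * biBubbleTable (Ga n a) (Ga n a) (SbRc n a cE cR cK cQ) SbT μ ν (b + w) b,
      fun w : Pt => toReal w μ * toReal w ν * biBubbleTable (Ga n a) (Ga n a) (SbRc n a cE cR cK cQ) (SbRc n a cE cR cK cQ) μ ν (b + w) b,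
      fun w : Pt => toReal w μ * toReal w ν * biBubbleTable (Ggh n a) (Ggh n a) ghCur (qAntiAt (ctrHalf n) n) μ ν (b + w) b,
      fun w : Pt => toReal w μ * toReal w ν * biBubbleTable (Ggh n a) (Ggh n a) (qAntiAt (ctrHalf n) n) ghCur μ ν (b + w) b,
      fun w : Pt => toReal w μ * toReal w ν * biBubbleTable (Ggh n a) (Ggh n a) (qAntiAt (ctrHalf n) n) (qAntiAt (ctrHalf n) n) μ ν (b + w) b,
      fun w : Pt => toReal w μ * toReal w ν * tadpoleTableA (Ggh n a) (WghAt (ctrHalf n) n x₀ cK cQ) μ ν (b + w) b,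
      fun w : Pt => toReal w μ * toReal w ν * tadpoleTable n a WQ μ ν (b + w) b] with hK
  set c : Fin 8 → ℝ := ![ωgl * cE, ωgl * cE, ωgl, ωgh * (cK * cQ), ωgh * (cQ * cK), ωgh * (cQ * cQ), ωgh, ωgl * cQ₂] with hc
  have hconv : ∀ i ∈ (univ : Finset (Fin 8)), ∃ L, Tendsto (psum (K i)) atTop (𝓝 L) := by
    intro i _
    fin_cases i
    · exact conv_bubble hGa hGa biLoc_SbT' (biLoc_SbRc' n a cE cR cK cQ ha) μ ν b
    · exact conv_bubble hGa hGa (biLoc_SbRc' n a cE cR cK cQ ha) biLoc_SbT' μ ν b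
    · exact conv_bubble hGa hGa (biLoc_SbRc' n a cE cR cK cQ ha) (biLoc_SbRc' n a cE cR cK cQ ha) μ ν b
    · exact conv_bubble hGgh hGgh biLoc_ghCur' (biLoc_qA' n) μ ν b
    · exact conv_bubble hGgh hGgh (biLoc_qA' n) biLoc_ghCur' μ ν b
    · exact conv_bubble hGgh hGgh (biLoc_qA' n) (biLoc_qA' n) μ ν b
    · exact conv_tadpoleA hGgh (div_pos one_pos (by exact_mod_cast Nat.pos_of_ne_zero (NeZero.ne n)))
        (biLoc_WghAt_ctr n x₀ cK cQ) μ ν b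
    · exact conv_tadpoleA hGa hδW hQ μ ν b
  -- the integrand, pointwise
  have e : (fun w : Pt => ∑ τ ∈ needleFibre', restK' n a g cE cΛ cR cK cQ cE₂ cJ4 cΛ₂ cR₂ cQ₂ x₀ WE WJ WΛ WR WQ ωgl ωgh lam N μ ν b τ w)
      = fun w : Pt => ((n : ℝ) ^ 8)⁻¹ * ∑ i : Fin 8, c i * K i w := by
    funext w
    rw [sum_needleFibre'_restK' n a cE cΛ cR cK cQ cE₂ cJ4 cΛ₂ cR₂ cQ₂ x₀ WE WJ WΛ WR WQ ωgl ωgh lam N μ ν b ha hGa hδ hg hδW hQ w,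
      Fin.sum_univ_eight]
    simp only [hK, hc, Matrix.cons_val_zero, Matrix.cons_val_one, Matrix.cons_val]
    ring
  have hsum : ∃ L, Tendsto (psum (fun w : Pt => ∑ i : Fin 8, c i * K i w)) atTop (𝓝 L) :=
    exists_tendsto_psum_finset_sum _ fun i hi => exists_tendsto_psum_const_mul (c i) (hconv i hi)
  rw [e, fullSum_const_mul _ hsum, fullSum_finset_sum_const_mul univ c hconv, Fin.sum_univ_eight]
  simp only [hK, hc, Matrix.cons_val_zero, Matrix.cons_val_one, Matrix.cons_val]
  ring

end Fixed

/-! ## §3 In the END's currency: the needle row from eight displayed table-row bounds -/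

section Packaged

variable {a N : ℝ} {μ ν : Fin 4} {cE cΛ cR cK cQ cE₂ cJ4 cΛ₂ cR₂ cQ₂ x₀ ωgl ωgh : ℕ → ℝ} {WE WJ WΛ WR WQ : ℕ → TableR}
  {CQ δW : ℕ → ℝ} {G : Type*} [DecidableEq G] {grp : RestIdx → G} {gN : G}

/-- [folklore] **ROAD BF-x, THE NEEDLE ROW OF THE END OF RECORD FROM EIGHT TABLE ROWS** (owner «NEEDLE-GLUE»; the hypothesis `hGrp` of
`RoadEndBFxTotalShellGroups.d1Drift_BFx_total_shell_of_prop12_of_groups` at the label value `gN` whose fibre is `needleFibre'`): given `0 < a`, the (α)-leaf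
`Spr (Ga n a)` along the block sizes, the slot-4 socket `hQ` (the END's own), the fibre datum `hfib`, and ONE n-uniform bound per table row `h₁ … h₈` — the
(N-2) currency `coef n · Σ_{b ∈ image resSite} n⁻⁴ · (n⁻⁸ · fullSum (w ↦ w_μ w_ν · T n μ ν (b+w) b))` —, the END's needle row is bounded by `C₁ + ⋯ + C₈`
at every block size `n ≥ 2`.  NOTHING is estimated here. -/
theorem abs_gN_row_le_of_tables (hfib : ∀ τ : RestIdx, grp τ = gN ↔ τ ∈ needleFibre') (ha : 0 < a)
    (hGa : ∀ n : ℕ, 2 ≤ n → ∀ [NeZero n], Spr (Ga n a)) (hδW : ∀ n, 0 < δW n)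
    (hQ : ∀ n κ u l u', BiLoc (WQ n κ u l u') u u' (CQ n) (δW n)) {C₁ C₂ C₃ C₄ C₅ C₆ C₇ C₈ : ℝ}
    (h₁ : ∀ n : ℕ, 2 ≤ n → ∀ [NeZero n], |ωgl n * cE n * ∑ b ∈ (univ : Finset (Fin 4 → Fin n)).image resSite, ((n : ℝ) ^ 4)⁻¹ * (((n : ℝ) ^ 8)⁻¹ *
      fullSum (fun w : Pt => toReal w μ * toReal w ν *
        biBubbleTable (Ga n a) (Ga n a) SbT (SbRc n a (cE n) (cR n) (cK n) (cQ n)) μ ν (b + w) b))| ≤ C₁)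
    (h₂ : ∀ n : ℕ, 2 ≤ n → ∀ [NeZero n], |ωgl n * cE n * ∑ b ∈ (univ : Finset (Fin 4 → Fin n)).image resSite, ((n : ℝ) ^ 4)⁻¹ * (((n : ℝ) ^ 8)⁻¹ *
      fullSum (fun w : Pt => toReal w μ * toReal w ν *
        biBubbleTable (Ga n a) (Ga n a) (SbRc n a (cE n) (cR n) (cK n) (cQ n)) SbT μ ν (b + w) b))| ≤ C₂)
    (h₃ : ∀ n : ℕ, 2 ≤ n → ∀ [NeZero n], |ωgl n * ∑ b ∈ (univ : Finset (Fin 4 → Fin n)).image resSite, ((n : ℝ) ^ 4)⁻¹ * (((n : ℝ) ^ 8)⁻¹ *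
      fullSum (fun w : Pt => toReal w μ * toReal w ν *
        biBubbleTable (Ga n a) (Ga n a) (SbRc n a (cE n) (cR n) (cK n) (cQ n)) (SbRc n a (cE n) (cR n) (cK n) (cQ n)) μ ν (b + w) b))| ≤ C₃)
    (h₄ : ∀ n : ℕ, 2 ≤ n → ∀ [NeZero n], |ωgh n * (cK n * cQ n) * ∑ b ∈ (univ : Finset (Fin 4 → Fin n)).image resSite, ((n : ℝ) ^ 4)⁻¹ *
      (((n : ℝ) ^ 8)⁻¹ * fullSum (fun w : Pt => toReal w μ * toReal w ν *
        biBubbleTable (Ggh n a) (Ggh n a) ghCur (qAntiAt (ctrHalf n) n) μ ν (b + w) b))| ≤ C₄)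
    (h₅ : ∀ n : ℕ, 2 ≤ n → ∀ [NeZero n], |ωgh n * (cQ n * cK n) * ∑ b ∈ (univ : Finset (Fin 4 → Fin n)).image resSite, ((n : ℝ) ^ 4)⁻¹ *
      (((n : ℝ) ^ 8)⁻¹ * fullSum (fun w : Pt => toReal w μ * toReal w ν *
        biBubbleTable (Ggh n a) (Ggh n a) (qAntiAt (ctrHalf n) n) ghCur μ ν (b + w) b))| ≤ C₅)
    (h₆ : ∀ n : ℕ, 2 ≤ n → ∀ [NeZero n], |ωgh n * (cQ n * cQ n) * ∑ b ∈ (univ : Finset (Fin 4 → Fin n)).image resSite, ((n : ℝ) ^ 4)⁻¹ *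
      (((n : ℝ) ^ 8)⁻¹ * fullSum (fun w : Pt => toReal w μ * toReal w ν *
        biBubbleTable (Ggh n a) (Ggh n a) (qAntiAt (ctrHalf n) n) (qAntiAt (ctrHalf n) n) μ ν (b + w) b))| ≤ C₆)
    (h₇ : ∀ n : ℕ, 2 ≤ n → ∀ [NeZero n], |ωgh n * ∑ b ∈ (univ : Finset (Fin 4 → Fin n)).image resSite, ((n : ℝ) ^ 4)⁻¹ * (((n : ℝ) ^ 8)⁻¹ *
      fullSum (fun w : Pt => toReal w μ * toReal w ν *
        tadpoleTableA (Ggh n a) (WghAt (ctrHalf n) n (x₀ n) (cK n) (cQ n)) μ ν (b + w) b))| ≤ C₇)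
    (h₈ : ∀ n : ℕ, 2 ≤ n → ∀ [NeZero n], |ωgl n * cQ₂ n * ∑ b ∈ (univ : Finset (Fin 4 → Fin n)).image resSite, ((n : ℝ) ^ 4)⁻¹ * (((n : ℝ) ^ 8)⁻¹ *
      fullSum (fun w : Pt => toReal w μ * toReal w ν * tadpoleTable n a (WQ n) μ ν (b + w) b))| ≤ C₈) :
    ∀ n : ℕ, 2 ≤ n → ∀ [NeZero n],
      |∑ b ∈ (univ : Finset (Fin 4 → Fin n)).image resSite, ((n : ℝ) ^ 4)⁻¹ *
        fullSum (fun w : Pt => ∑ τ ∈ (univ : Finset RestIdx).filter (fun τ => grp τ = gN),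
          restK' n a (gfrz n a b) (cE n) (cΛ n) (cR n) (cK n) (cQ n) (cE₂ n) (cJ4 n) (cΛ₂ n) (cR₂ n) (cQ₂ n) (x₀ n)
            (WE n) (WJ n) (WΛ n) (WR n) (WQ n) (ωgl n) (ωgh n) ((n : ℝ) ^ 8) N μ ν b τ w)|
        ≤ C₁ + C₂ + C₃ + C₄ + C₅ + C₆ + C₇ + C₈ := by
  intro n hn _
  classical
  -- the fibre of `gN` is the needle fibre of record
  have hset : (univ : Finset RestIdx).filter (fun τ => grp τ = gN) = needleFibre' := by
    ext τ
    simp only [mem_filter, mem_univ, true_and]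
    exact hfib τ
  -- the eight table rows (with their coefficients) and their bounds
  set Y : Fin 8 → ℝ := ![
      ωgl n * cE n * ∑ b ∈ (univ : Finset (Fin 4 → Fin n)).image resSite, ((n : ℝ) ^ 4)⁻¹ * (((n : ℝ) ^ 8)⁻¹ *
        fullSum (fun w : Pt => toReal w μ * toReal w ν * biBubbleTable (Ga n a) (Ga n a) SbT (SbRc n a (cE n) (cR n) (cK n) (cQ n)) μ ν (b + w) b)),
      ωgl n * cE n * ∑ b ∈ (univ : Finset (Fin 4 → Fin n)).image resSite, ((n : ℝ) ^ 4)⁻¹ * (((n : ℝ) ^ 8)⁻¹ *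
        fullSum (fun w : Pt => toReal w μ * toReal w ν * biBubbleTable (Ga n a) (Ga n a) (SbRc n a (cE n) (cR n) (cK n) (cQ n)) SbT μ ν (b + w) b)),
      ωgl n * ∑ b ∈ (univ : Finset (Fin 4 → Fin n)).image resSite, ((n : ℝ) ^ 4)⁻¹ * (((n : ℝ) ^ 8)⁻¹ *
        fullSum (fun w : Pt => toReal w μ * toReal w ν *
          biBubbleTable (Ga n a) (Ga n a) (SbRc n a (cE n) (cR n) (cK n) (cQ n)) (SbRc n a (cE n) (cR n) (cK n) (cQ n)) μ ν (b + w) b)),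
      ωgh n * (cK n * cQ n) * ∑ b ∈ (univ : Finset (Fin 4 → Fin n)).image resSite, ((n : ℝ) ^ 4)⁻¹ * (((n : ℝ) ^ 8)⁻¹ *
        fullSum (fun w : Pt => toReal w μ * toReal w ν * biBubbleTable (Ggh n a) (Ggh n a) ghCur (qAntiAt (ctrHalf n) n) μ ν (b + w) b)),
      ωgh n * (cQ n * cK n) * ∑ b ∈ (univ : Finset (Fin 4 → Fin n)).image resSite, ((n : ℝ) ^ 4)⁻¹ * (((n : ℝ) ^ 8)⁻¹ *
        fullSum (fun w : Pt => toReal w μ * toReal w ν * biBubbleTable (Ggh n a) (Ggh n a) (qAntiAt (ctrHalf n) n) ghCur μ ν (b + w) b)),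
      ωgh n * (cQ n * cQ n) * ∑ b ∈ (univ : Finset (Fin 4 → Fin n)).image resSite, ((n : ℝ) ^ 4)⁻¹ * (((n : ℝ) ^ 8)⁻¹ *
        fullSum (fun w : Pt => toReal w μ * toReal w ν *
          biBubbleTable (Ggh n a) (Ggh n a) (qAntiAt (ctrHalf n) n) (qAntiAt (ctrHalf n) n) μ ν (b + w) b)),
      ωgh n * ∑ b ∈ (univ : Finset (Fin 4 → Fin n)).image resSite, ((n : ℝ) ^ 4)⁻¹ * (((n : ℝ) ^ 8)⁻¹ *
        fullSum (fun w : Pt => toReal w μ * toReal w ν * tadpoleTableA (Ggh n a) (WghAt (ctrHalf n) n (x₀ n) (cK n) (cQ n)) μ ν (b + w) b)),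
      ωgl n * cQ₂ n * ∑ b ∈ (univ : Finset (Fin 4 → Fin n)).image resSite, ((n : ℝ) ^ 4)⁻¹ * (((n : ℝ) ^ 8)⁻¹ *
        fullSum (fun w : Pt => toReal w μ * toReal w ν * tadpoleTable n a (WQ n) μ ν (b + w) b))] with hY
  set Cv : Fin 8 → ℝ := ![C₁, C₂, C₃, C₄, C₅, C₆, C₇, C₈] with hCv
  have hYle : ∀ i ∈ (univ : Finset (Fin 8)), |Y i| ≤ Cv i := by
    intro i _
    fin_cases i
    · exact h₁ n hn
    · exact h₂ n hn
    · exact h₃ n hn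
    · exact h₄ n hn
    · exact h₅ n hn
    · exact h₆ n hn
    · exact h₇ n hn
    · exact h₈ n hn
  -- the row, base site by base site, through §2 at the frozen profile
  have hrow : ∑ b ∈ (univ : Finset (Fin 4 → Fin n)).image resSite, ((n : ℝ) ^ 4)⁻¹ *
      fullSum (fun w : Pt => ∑ τ ∈ (univ : Finset RestIdx).filter (fun τ => grp τ = gN),
        restK' n a (gfrz n a b) (cE n) (cΛ n) (cR n) (cK n) (cQ n) (cE₂ n) (cJ4 n) (cΛ₂ n) (cR₂ n) (cQ₂ n) (x₀ n)
          (WE n) (WJ n) (WΛ n) (WR n) (WQ n) (ωgl n) (ωgh n) ((n : ℝ) ^ 8) N μ ν b τ w)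
      = ∑ i : Fin 8, Y i := by
    rw [hset]
    have hb : ∀ b ∈ (univ : Finset (Fin 4 → Fin n)).image resSite, ((n : ℝ) ^ 4)⁻¹ *
        fullSum (fun w : Pt => ∑ τ ∈ needleFibre',
          restK' n a (gfrz n a b) (cE n) (cΛ n) (cR n) (cK n) (cQ n) (cE₂ n) (cJ4 n) (cΛ₂ n) (cR₂ n) (cQ₂ n) (x₀ n)
            (WE n) (WJ n) (WΛ n) (WR n) (WQ n) (ωgl n) (ωgh n) ((n : ℝ) ^ 8) N μ ν b τ w)
        = (ωgl n * cE n) * (((n : ℝ) ^ 4)⁻¹ * (((n : ℝ) ^ 8)⁻¹ *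
            fullSum (fun w : Pt => toReal w μ * toReal w ν * biBubbleTable (Ga n a) (Ga n a) SbT (SbRc n a (cE n) (cR n) (cK n) (cQ n)) μ ν (b + w) b)))
          + (ωgl n * cE n) * (((n : ℝ) ^ 4)⁻¹ * (((n : ℝ) ^ 8)⁻¹ *
            fullSum (fun w : Pt => toReal w μ * toReal w ν * biBubbleTable (Ga n a) (Ga n a) (SbRc n a (cE n) (cR n) (cK n) (cQ n)) SbT μ ν (b + w) b)))
          + ωgl n * (((n : ℝ) ^ 4)⁻¹ * (((n : ℝ) ^ 8)⁻¹ *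
            fullSum (fun w : Pt => toReal w μ * toReal w ν *
              biBubbleTable (Ga n a) (Ga n a) (SbRc n a (cE n) (cR n) (cK n) (cQ n)) (SbRc n a (cE n) (cR n) (cK n) (cQ n)) μ ν (b + w) b)))
          + (ωgh n * (cK n * cQ n)) * (((n : ℝ) ^ 4)⁻¹ * (((n : ℝ) ^ 8)⁻¹ *
            fullSum (fun w : Pt => toReal w μ * toReal w ν * biBubbleTable (Ggh n a) (Ggh n a) ghCur (qAntiAt (ctrHalf n) n) μ ν (b + w) b)))
          + (ωgh n * (cQ n * cK n)) * (((n : ℝ) ^ 4)⁻¹ * (((n : ℝ) ^ 8)⁻¹ *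
            fullSum (fun w : Pt => toReal w μ * toReal w ν * biBubbleTable (Ggh n a) (Ggh n a) (qAntiAt (ctrHalf n) n) ghCur μ ν (b + w) b)))
          + (ωgh n * (cQ n * cQ n)) * (((n : ℝ) ^ 4)⁻¹ * (((n : ℝ) ^ 8)⁻¹ *
            fullSum (fun w : Pt => toReal w μ * toReal w ν *
              biBubbleTable (Ggh n a) (Ggh n a) (qAntiAt (ctrHalf n) n) (qAntiAt (ctrHalf n) n) μ ν (b + w) b)))
          + ωgh n * (((n : ℝ) ^ 4)⁻¹ * (((n : ℝ) ^ 8)⁻¹ *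
            fullSum (fun w : Pt => toReal w μ * toReal w ν * tadpoleTableA (Ggh n a) (WghAt (ctrHalf n) n (x₀ n) (cK n) (cQ n)) μ ν (b + w) b)))
          + (ωgl n * cQ₂ n) * (((n : ℝ) ^ 4)⁻¹ * (((n : ℝ) ^ 8)⁻¹ *
            fullSum (fun w : Pt => toReal w μ * toReal w ν * tadpoleTable n a (WQ n) μ ν (b + w) b))) := by
      intro b _
      obtain ⟨C', δ', hδ', hgb⟩ := decay_gfrz (hGa n hn) b
      rw [fullSum_needleFibre'_eq n a (cE n) (cΛ n) (cR n) (cK n) (cQ n) (cE₂ n) (cJ4 n) (cΛ₂ n) (cR₂ n) (cQ₂ n) (x₀ n) (WE n) (WJ n) (WΛ n)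
        (WR n) (WQ n) (ωgl n) (ωgh n) ((n : ℝ) ^ 8) N μ ν b ha (hGa n hn) hδ' hgb (hδW n) (hQ n)]
      ring
    rw [sum_congr rfl hb, sum_add_distrib, sum_add_distrib, sum_add_distrib, sum_add_distrib, sum_add_distrib, sum_add_distrib,
      sum_add_distrib, Fin.sum_univ_eight]
    simp only [hY, Matrix.cons_val_zero, Matrix.cons_val_one, Matrix.cons_val, mul_sum]
  rw [hrow]
  calc |∑ i : Fin 8, Y i| ≤ ∑ i : Fin 8, |Y i| := abs_sum_le_sum_abs _ _
    _ ≤ ∑ i : Fin 8, Cv i := sum_le_sum hYle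
    _ = C₁ + C₂ + C₃ + C₄ + C₅ + C₆ + C₇ + C₈ := by
      rw [Fin.sum_univ_eight]
      simp only [hCv, Matrix.cons_val_zero, Matrix.cons_val_one, Matrix.cons_val]

end Packaged

end Summit.QuantumFields.BalabanUV.Beta.D1BFx.NeedleRowGlue

end
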